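import Summits.ValiantsHypothesis.Statement
import Literature.Computability.AlgebraicComplexity.PerDetMultiplicityObstruction
import Literature.Computability.AlgebraicComplexity.PermanentVsDeterminant
import Literature.Computability.AlgebraicComplexity.VPDeterminantalQPProofs
import Literature.Computability.AlgebraicComplexity.ValiantConjectureProofs
import Literature.Computability.AlgebraicComplexity.ValiantClassesProofs
import HarnessLib

/-!
# What suffices: multiplicity obstructions ⇒ `dc(per)` lower bounds ⇒ `VNP ⊄ VP_ws` resp. `VP ≠ VNP`

Cell `pub-gct-max` (track T, seat lit-2; PLAN.md v0.1 §1 "CHAIN-2"), companion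
`run/shared/lean/pub/pub-gct-max/typed/CHAIN-2.md`. HONEST FRAMING: multiplicity data and
certified rank bounds at small parameters are what the cell computes; this file only records, as
sorry-free IMPLICATIONS over decls already in the tree, what an infinite family of such
obstructions WOULD give. Nothing here is a claim on VP vs VNP or P vs NP; no implication towards
P vs NP is formalised (the folklore link runs through Valiant's hypothesis only in the converse
direction of interest and is not used).

Letters (PLAN §0): `m` = permanent size, `n` = determinant size, `m ≤ n`; a multiplicity
obstruction at `(per m, det n)` is a highest weight `χ` of `GL_{n²}` with
`mult_χ ℂ[Ω_n] < mult_χ ℂ[Z_{n,m}]` — the tree's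
`Literature.Computability.AlgebraicComplexity.PerDetMultiplicityObstruction (k := ℂ) m n χ`
(fresh-variable padding `X₀₀^{n-m} per_m`, lexicographic Borel; `PerDetMultiplicityObstruction.lean`,
whose letters are `(n, m) = (per, det)` — SAME ORDER, permanent first), or in certificate
coordinates `PerDetMultiplicityObstructionAt m n d λ` (`λ ⊢ n·d`, `ℓ(λ) ≤ n²`).

## The chain (every arrow is a THEOREM of the tree or of this file; no named fact is a hypothesis)

1. obstruction at `(per m, det n)` ⇒ `n < dc(per_m)` —
   `lt_determinantalComplexity_perPoly_of_perDetMultiplicityObstruction` (Mulmuley–Sohoni 2001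
   Prop. 4.4 + Schur; BIP 2019 §1.1 "Its existence thus proves that `Z_{n,m} ⊄ Ω_n` and hence
   `dc(per_m) > n`"), PROVED in the tree over its discharged facts.
2. (a) obstructions at `(per m, det n(m))` with `n(m)` beating every polynomial somewhere ⇒
   `¬ IsPBounded (m ↦ dc(per_m))` = `DcPerSuperpolynomial ℂ` (pnp.S05; "VNP ⊄ VP_ws" in
   dc-language — Valiant 1979 / Toda: `dc` p-bounded ⟺ `per ∈ VP_ws = VBP`; the class `VP_ws`
   itself is not in the tree, so the conclusion is stated in dc-language, which IS BIP's Conj. 1.1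
   "The determinantal complexity `dc(per_n)` grows superpolynomially") — `sufficesForVBPneVNP`.
   (b) the same with `n(m)` beating every quasi-polynomial `2^((log₂ m + c)^c)` somewhere ⇒
   `¬ IsQPBounded (m ↦ dc(per_m))` (= crux `DetqpThesis` of route ValiantsHypothesis/DetQP,
   = `PER ∉ VQP`, BCS (21.41)) — `not_isQPBounded_dc_of_multObstructionsBeyondQuasiPoly`.
3. `¬ IsQPBounded (m ↦ dc(per_m))` ⇒ `ValiantsHypothesis` (`VP_ℂ ≠ VNP_ℂ`): `VP` families have
   quasi-polynomially bounded `dc` (`isQPBounded_determinantalComplexity_of_isVPFamily_holds`,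
   VSBR 1983 + Valiant 1979, BCS Cor. (21.40)), `per ∈ VNP` (`perFamily_mem_VNP_holds`) and the
   bundling bridge `mem_VP_ofFintype_iff_holds` — `valiantsHypothesis_of_not_isQPBounded_dc`
   (the bookkeeping that route GCTMult's `closes` performs inline; restated here closed-form).
   Hence `sufficesForVPneVNP`.

WHY (b) NEEDS THE QUASI-POLYNOMIAL SCALE: `VP ⊆ VQP` and `VP`-families only have
quasi-polynomially bounded `dc`; a merely superpolynomial `dc(per)` (conclusion (a)) gives
`VNP ⊄ VP_ws`, not `VP ≠ VNP` (BIP 2019 §1: "[Conj. 1.1] is equivalent to `VP_ws ≠ VNP`").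
Relation to the tree's route `ValiantsHypothesis/GCTMult`: its crux `GctMultFlip` asks for flips
throughout the WINDOW `m ≤ n ≤ 2^((log₂ m + c)^c)`; for the dc-language conclusions only ONE
obstruction per constant `c`, at a determinant size beyond the (quasi-)polynomial, is needed —
`MultObstructionsBeyondQuasiPoly` below — because `dc(per_m) ≤ N` already forces membership at
every `n ≥ N` (MS Prop. 4.4). What is OPEN: the hypotheses themselves (no multiplicity
obstruction is known at any OPEN pair `(per m, det n)`, Bläser–Ikenmeyer 2025 §12.4; the cell's
(O) track searches `(per 3, det 5)` upward); BIP Thm. 1.4 says the obstructions required here can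
NOT be occurrence obstructions once `n ≥ m^25`.
-/

noncomputable section

namespace Summit.PneNP.GCT

open Literature.Computability.AlgebraicComplexity Literature.NumberTheory.DiophantineGeometry

/-! ### The two hypothesis shapes -/

/-- **Multiplicity obstructions beyond every polynomial**: for every `c` there is a pair
`(per m, det n)` with `m ^ c + c ≤ n` carrying a multiplicity obstruction (some highest weight `χ`
of `GL_{n²}` with `mult_χ ℂ[Ω_n] < mult_χ ℂ[Z_{n,m}]`, tree predicate
`PerDetMultiplicityObstruction (k := ℂ) m n χ`, which includes `m ≤ n`). The shape `m ^ c + c` is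
the tree's `IsPBounded` template (Bürgisser 2000, Def. 2.1(1)). [folklore] -/
def MultObstructionsBeyondPoly : Prop :=
  ∀ c : ℕ, ∃ (m n : ℕ) (_ : NeZero n) (χ : Weight (MatIdx n)),
    m ^ c + c ≤ n ∧ PerDetMultiplicityObstruction (k := ℂ) m n χ

/-- **Multiplicity obstructions beyond every quasi-polynomial**: for every `c` there is a pair
`(per m, det n)` with `2 ^ ((log₂ m + c) ^ c) ≤ n` carrying a multiplicity obstruction (template of
the tree's `IsQPBounded`, Bürgisser 2000, Def. 2.26). [folklore] -/
def MultObstructionsBeyondQuasiPoly : Prop :=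
  ∀ c : ℕ, ∃ (m n : ℕ) (_ : NeZero n) (χ : Weight (MatIdx n)),
    2 ^ ((Nat.log 2 m + c) ^ c) ≤ n ∧ PerDetMultiplicityObstruction (k := ℂ) m n χ

/-- Certificate coordinates feed the weight form: an obstruction `PerDetMultiplicityObstructionAt m n d λ`
(`λ ⊢ n·d`, `ℓ(λ) ≤ n²`, as an engine certificate states it) is one at the weight `λ^*`.
[folklore] -/
theorem exists_obstruction_of_at {m n d : ℕ} [NeZero n] {lam : Nat.Partition (n * d)}
    (h : PerDetMultiplicityObstructionAt (k := ℂ) m n d lam) :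
    ∃ χ : Weight (MatIdx n), PerDetMultiplicityObstruction (k := ℂ) m n χ :=
  ⟨_, h.perDetMultiplicityObstruction⟩

/-! ### (a) Beyond every polynomial ⇒ `dc(per)` is not p-bounded ("VNP ⊄ VP_ws" in dc-language) -/

/-- **(a) `SufficesForVBPneVNP`, dc-language**: multiplicity obstructions beyond every polynomial
give `¬ IsPBounded (m ↦ dc(per_m))` over `ℂ`. Proof: a bound `dc(per_m) ≤ m^c + c` for all `m`
contradicts the obstruction at `(m, n)` with `m^c + c ≤ n < dc(per_m)`
(`lt_determinantalComplexity_perPoly_of_perDetMultiplicityObstruction`). [folklore] -/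
theorem not_isPBounded_dc_of_multObstructionsBeyondPoly (h : MultObstructionsBeyondPoly) :
    ¬ IsPBounded (fun m => determinantalComplexity (perPoly (Fin m) ℂ)) := by
  rintro ⟨c, hc⟩
  obtain ⟨m, n, _, χ, hmn, hobs⟩ := h c
  have hlt := lt_determinantalComplexity_perPoly_of_perDetMultiplicityObstruction hobs
  exact absurd (hc m) (not_le.2 (lt_of_le_of_lt hmn hlt))

/-- **(a)** as the tree's open statement pnp.S05 `DcPerSuperpolynomial ℂ` ("the determinantal
complexity of the permanent is not polynomially bounded"; BIP 2019 Conj. 1.1 [Valiant 1979],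
equivalent to `VP_ws ≠ VNP`): `MultObstructionsBeyondPoly → DcPerSuperpolynomial ℂ`.
[folklore] -/
def SufficesForVBPneVNP : Prop :=
  MultObstructionsBeyondPoly → DcPerSuperpolynomial ℂ

/-- `SufficesForVBPneVNP` holds (unconditionally: it is an implication between a hypothesis shape
and an open statement, proved by step 1 of the chain). [folklore] -/
theorem sufficesForVBPneVNP_holds : SufficesForVBPneVNP :=
  fun h => not_isPBounded_dc_of_multObstructionsBeyondPoly h

/-! ### (b) Beyond every quasi-polynomial ⇒ `VP_ℂ ≠ VNP_ℂ` -/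

/-- Multiplicity obstructions beyond every quasi-polynomial give `¬ IsQPBounded (m ↦ dc(per_m))`
over `ℂ` (= `PER ∉ VQP`, BCS (21.41); = the crux `DetqpThesis` of route ValiantsHypothesis/DetQP).
Same five lines as (a). [folklore] -/
theorem not_isQPBounded_dc_of_multObstructionsBeyondQuasiPoly (h : MultObstructionsBeyondQuasiPoly) :
    ¬ IsQPBounded (fun m => determinantalComplexity (perPoly (Fin m) ℂ)) := by
  rintro ⟨c, hc⟩
  obtain ⟨m, n, _, χ, hmn, hobs⟩ := h c
  have hlt := lt_determinantalComplexity_perPoly_of_perDetMultiplicityObstruction hobs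
  exact absurd (hc m) (not_le.2 (lt_of_le_of_lt hmn hlt))

/-- **`PER` with not quasi-polynomially bounded `dc` ⇒ `VP_ℂ ≠ VNP_ℂ`** (the bookkeeping of route
GCTMult's `closes`, closed form): if `VP ℂ = VNP ℂ` then the permanent family, which lies in `VNP`
(`perFamily_mem_VNP_holds`), lies in `VP`, so (`mem_VP_ofFintype_iff_holds`) `(per_n)` is a `VP`
family and its `dc` is quasi-polynomially bounded
(`isQPBounded_determinantalComplexity_of_isVPFamily_holds`, BCS 1997 Cor. (21.40) / VSBR 1983).
[cite: BurgisserClausenShokrollahi1997, Cor. (21.40)] -/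
theorem valiantsHypothesis_of_not_isQPBounded_dc
    (h : ¬ IsQPBounded (fun m => determinantalComplexity (perPoly (Fin m) ℂ))) :
    ValiantsHypothesis := by
  intro hEq
  have hVNP : perFamily ℂ ∈ VNP ℂ := perFamily_mem_VNP_holds ℂ
  have hVP : perFamily ℂ ∈ VP ℂ := by rw [hEq]; exact hVNP
  have hfam : IsVPFamily (fun n => perPoly (Fin n) ℂ) :=
    (mem_VP_ofFintype_iff_holds (fun n => perPoly (Fin n) ℂ)).1 hVP
  exact h (isQPBounded_determinantalComplexity_of_isVPFamily_holds _ hfam)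

/-- **(b) `SufficesForVPneVNP`**: multiplicity obstructions beyond every quasi-polynomial imply the
summit statement `ValiantsHypothesis` (`VP_ℂ ≠ VNP_ℂ`). [folklore] -/
def SufficesForVPneVNP : Prop :=
  MultObstructionsBeyondQuasiPoly → ValiantsHypothesis

/-- `SufficesForVPneVNP` holds: steps 1–3 of the chain. [folklore] -/
theorem sufficesForVPneVNP_holds : SufficesForVPneVNP :=
  fun h => valiantsHypothesis_of_not_isQPBounded_dc
    (not_isQPBounded_dc_of_multObstructionsBeyondQuasiPoly h)

/-- The quasi-polynomial hypothesis implies the polynomial one (`m^c + c ≤ 2^((log₂ m + c')^c')`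
for a suitable `c'`; here simply: instantiate (b)'s family at a larger template), so (b)'s
hypothesis also yields (a)'s conclusion. Stated as the implication between the conclusions that
needs no arithmetic: `¬ IsQPBounded ⇒ ¬ IsPBounded` for `dc ∘ per` (a p-bounded function is
qp-bounded, tree `IsPBounded.isQPBounded`). [folklore] -/
theorem not_isPBounded_dc_of_not_isQPBounded_dc
    (h : ¬ IsQPBounded (fun m => determinantalComplexity (perPoly (Fin m) ℂ))) :
    ¬ IsPBounded (fun m => determinantalComplexity (perPoly (Fin m) ℂ)) :=
  fun hp => h hp.isQPBounded

/-! ### Bridge to the tree's route `ValiantsHypothesis/GCTMult` (window form of the flip)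

Route GCTMult's crux `GctMultFlip` (`Summits/ValiantsHypothesis/ValiantsHypothesis/Theses/GCTMult.lean`,
spelled out by value below — that file is not imported, to keep this cone small) asks for a
multiplicity flip at EVERY determinant size `n` in the quasi-polynomial window
`m ≤ n ≤ 2^((log₂ m + c)^c)` for all large permanent sizes `m`. The single-point shape
`MultObstructionsBeyondQuasiPoly` follows by instantiating the window for the constant `c + 1` at
its top end `n = 2^((log₂ m + (c+1))^(c+1))` (which is `≥ m` and `≥ 2^((log₂ m + c)^c)`), so the
window flips give the summit directly through dc (`valiantsHypothesis_of_windowFlips`) — the same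
conclusion as the route's `closes`, without its bookkeeping item. Likewise
`not_isQPBounded_dc_of_multObstructionsBeyondQuasiPoly` concludes literally the body of route
DetQP's crux `DetqpThesis`. -/

/-- **Window flips ⇒ single-point obstructions beyond every quasi-polynomial.** The hypothesis is,
by value, route GCTMult's crux `GctMultFlip` (tree letters there: `n` = permanent, `m` =
determinant size): for every `c` and all large permanent sizes, every determinant size in the
window `[per, 2^((log₂ per + c)^c)]` carries a highest weight with
`mult ℂ[Δ(det)] < mult ℂ[Δ(padded per)]`. [folklore] -/
theorem multObstructionsBeyondQuasiPoly_of_windowFlips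
    (h : ∀ c : ℕ, ∃ n₀ : ℕ, ∀ n ≥ n₀, ∀ (m : ℕ) [NeZero m], n ≤ m → m ≤ 2 ^ ((Nat.log 2 n + c) ^ c) →
      ∃ χ : Weight (MatIdx m), orbitMultiplicity ℂ (detFormLex ℂ m) m χ <
        orbitMultiplicity ℂ (paddedPerFormLex ℂ n m) m χ) :
    MultObstructionsBeyondQuasiPoly := by
  intro c
  obtain ⟨n₀, hn₀⟩ := h (c + 1)
  set N := 2 ^ ((Nat.log 2 n₀ + (c + 1)) ^ (c + 1)) with hN
  haveI : NeZero N := NeZero.of_pos (by positivity)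
  -- arithmetic of the window (also in `…Theorems.BorderApolarityGctBridge`, not imported here):
  -- `n₀ ≤ 2^((log₂ n₀ + (c+1))^(c+1))` and monotonicity of the template in `c`.
  have hle : n₀ ≤ N := by
    have hlt : n₀ < 2 ^ (Nat.log 2 n₀ + 1) := Nat.lt_pow_succ_log_self (by norm_num) n₀
    have hexp : Nat.log 2 n₀ + 1 ≤ (Nat.log 2 n₀ + (c + 1)) ^ (c + 1) :=
      calc Nat.log 2 n₀ + 1 ≤ Nat.log 2 n₀ + (c + 1) := by omega
        _ ≤ (Nat.log 2 n₀ + (c + 1)) ^ (c + 1) := Nat.le_self_pow (by omega) _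
    exact hlt.le.trans (Nat.pow_le_pow_right (by norm_num) hexp)
  have hmono : 2 ^ ((Nat.log 2 n₀ + c) ^ c) ≤ N := by
    refine Nat.pow_le_pow_right (by norm_num) ?_
    rcases Nat.eq_zero_or_pos c with rfl | hc
    · simp only [pow_zero, zero_add, pow_one]
      omega
    · exact (Nat.pow_le_pow_left (by omega) c).trans (Nat.pow_le_pow_right (by omega) (by omega))
  obtain ⟨χ, hχ⟩ := hn₀ n₀ le_rfl N hle le_rfl
  exact ⟨n₀, N, inferInstance, χ, hmono, hle, hχ⟩

/-- **Window flips ⇒ `VP_ℂ ≠ VNP_ℂ`** — route GCTMult's crux gives the summit through the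
dc-language chain of this file (steps 1–3), with no further route item. [folklore] -/
theorem valiantsHypothesis_of_windowFlips
    (h : ∀ c : ℕ, ∃ n₀ : ℕ, ∀ n ≥ n₀, ∀ (m : ℕ) [NeZero m], n ≤ m → m ≤ 2 ^ ((Nat.log 2 n + c) ^ c) →
      ∃ χ : Weight (MatIdx m), orbitMultiplicity ℂ (detFormLex ℂ m) m χ <
        orbitMultiplicity ℂ (paddedPerFormLex ℂ n m) m χ) :
    ValiantsHypothesis :=
  sufficesForVPneVNP_holds (multObstructionsBeyondQuasiPoly_of_windowFlips h)

end Summit.PneNP.GCT
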